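/-
Copyright: fleet lead `ym-wcr-19609-p1` (seat prover-ym-wcr-19609-p1-g0-0), route `WeakCouplingRates`.
-/
import Summits.QuantumFields.YangMills.Theses.WeakCouplingRates
import Summits.QuantumFields.YangMills.Theorems.EquipartitionCriticalityEquipartitionPinsProbeSecondDifference
import Literature.Probability.LatticeModels.LatticeGreenGradient

/-!
# Support item FLOOR `CurvatureCorrPowerFloor` (stmt-QuantumFields-19457) of route `WeakCouplingRates`: PROVED

WHAT.  `Summit.QuantumFields.YangMills.Theses.WeakCouplingRates.CurvatureCorrPowerFloor`:
`∃ κ > 0, ∃ n₀, ∀ n ≥ n₀, κ / n⁴ ≤ |curvaturePlaquetteCorr (d := 4) _ n|` — the `ℤ⁴` lattice-Maxwell Gaussian curvature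
plaquette two-point function along the `e₀` axis has an eventual power floor (numerics `π²n⁴C(n) → 1`).  The SAME statement is stub F1
`stub_curvatureCorrFloor` of `Cruxes/SofteningCentreBlind/Lines/birth.lean` (route ThermalRuler) and the FLOOR input of the glue
`xiPowSU2_of_box` of the rates route; with BOX_W it also yields the registered stub `stub_boxPolyFloor` of crux `BulkDominatesColdBoxW`
(`boxPolyFloor_of_box_floor`, module `WeakCouplingRatesBulkDominatesColdBoxWBoxPolyFloorOfBox`).

PROOF (two tree theorems and arithmetic): (1) `EquipartitionPinsProbe.stub_secondDifference` (route EquipartitionCriticality, proved):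
`c_n = ⅓ (G((n+1)e₀) + G((n−1)e₀) − 2G(ne₀))`, `G = latticeGreen` on `ℤ⁴`, `n ≠ 0` (sixteen-term expansion of `curvatureTwoPoint`,
transverse symmetry, harmonicity of `G` off the origin); (2) Lawler's Theorem 1.5.5 (1.37) in printed form,
`Literature.Probability.LatticeModels.latticeGreen_second_diff_continuum`:
`|∇²_{eᵢ}G(x) − a_d(2−d)(|x|^{−d} − d xᵢ²|x|^{−d−2})| ≤ K|x|^{−(d+1)}`, `a_4 = Γ(1)/(2π²) = 1/(2π²)`.  At `x = ne₀`, `i = 0`, `d = 4`: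
`|x| = n`, the main term is `a·(−2)·(n^{−4} − 4n^{−4}) = 6a/n⁴`, so `3c_n ≥ 6a/n⁴ − K/n⁵ ≥ 3a/n⁴` for `n ≥ K/(3a)`, i.e.
`c_n ≥ a/n⁴ = 1/(2π²n⁴)`: **κ = 1/(2π²)** (any κ < 1/π² would do).  NOT a claim about the mass gap: a statement about the free
lattice Maxwell field.

References: G. F. Lawler, *Intersections of Random Walks* (1991) Thm. 1.5.5; G. F. Lawler, V. Limic (2010) §4.3; C. Garban,
A. Sepúlveda (2023) (the curvature Gaussian field).
-/

set_option autoImplicit false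

noncomputable section

open Real
open Literature.Probability.LatticeModels
open Literature.MathematicalPhysics.QuantumFieldTheory

namespace Summit.QuantumFields.YangMills.Theorems.WeakCouplingRates

/-- On the axis of `ℤ⁴`: `Σ_j ((ne₀)_j)² = n²`. [folklore] -/
theorem sum_sq_single_zero (n : ℤ) :
    (∑ j : Fin 4, (((Pi.single (0 : Fin 4) n : Site 4) j : ℤ) : ℝ) ^ 2) = (n : ℝ) ^ 2 := by
  simp [Pi.single_apply]

/-- **The asymptotics of the axis plaquette numbers**: `|3 c_n − 6a/n⁴| ≤ K/n⁵` for `n ≥ 1`, `a = Γ(1)/(2π²)`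
(Lawler's (1.37) at `x = ne₀` through `c_n = ⅓∇²_{e₀}G(ne₀)`). [cite: Lawler1991, Thm. 1.5.5] -/
theorem curvaturePlaquetteCorr_axis_asymptotics : ∃ K : ℝ, 0 ≤ K ∧ ∀ n : ℕ, 1 ≤ n →
    |3 * curvaturePlaquetteCorr (d := 4) (by norm_num) (n : ℤ) -
        6 * (Real.Gamma ((4 : ℝ) / 2 - 1) / (2 * π ^ ((4 : ℝ) / 2))) / (n : ℝ) ^ 4| ≤ K / (n : ℝ) ^ 5 := by
  obtain ⟨K, hK0, hK⟩ := latticeGreen_second_diff_continuum (d := 4) (by norm_num)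
  refine ⟨K, hK0, fun n hn => ?_⟩
  have hn0 : (n : ℤ) ≠ 0 := by exact_mod_cast (show n ≠ 0 by omega)
  have hnR : (0 : ℝ) < n := by exact_mod_cast (show 0 < n by omega)
  set x : Site 4 := Pi.single (0 : Fin 4) (n : ℤ) with hx
  have hx0 : x ≠ 0 := by
    intro h
    have := congrFun h 0
    simp [hx] at this
    omega
  have h := hK x hx0 0
  -- the three axis points
  have e1 : x + Pi.single (0 : Fin 4) 1 = Pi.single (0 : Fin 4) ((n : ℤ) + 1) := by rw [hx, ← Pi.single_add]
  have e2 : x - Pi.single (0 : Fin 4) 1 = Pi.single (0 : Fin 4) ((n : ℤ) - 1) := by rw [hx, ← Pi.single_sub]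
  have hsq : Real.sqrt (∑ j : Fin 4, ((x j : ℤ) : ℝ) ^ 2) = n := by
    rw [hx, sum_sq_single_zero, Int.cast_natCast, Real.sqrt_sq hnR.le]
  have hx00 : ((x 0 : ℤ) : ℝ) = n := by simp [hx]
  rw [e1, e2, hsq, hx00] at h
  -- `c_n` as one third of the axial second difference
  have hc := EquipartitionPinsProbe.stub_secondDifference (n : ℤ) hn0
  -- rpow bookkeeping at `|x| = n > 0`
  have r4 : (n : ℝ) ^ (-((4 : ℕ) : ℝ)) = ((n : ℝ) ^ 4)⁻¹ := by
    rw [Real.rpow_neg hnR.le, Real.rpow_natCast]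
  have r6 : (n : ℝ) ^ (-(((4 : ℕ) : ℝ) + 2)) = ((n : ℝ) ^ 6)⁻¹ := by
    rw [Real.rpow_neg hnR.le, show ((4 : ℕ) : ℝ) + 2 = ((6 : ℕ) : ℝ) by norm_num, Real.rpow_natCast]
  have r5 : (n : ℝ) ^ (-(((4 : ℕ) : ℝ) + 1)) = ((n : ℝ) ^ 5)⁻¹ := by
    rw [Real.rpow_neg hnR.le, show ((4 : ℕ) : ℝ) + 1 = ((5 : ℕ) : ℝ) by norm_num, Real.rpow_natCast]
  simp only [Nat.cast_ofNat] at r4 r6 r5 h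
  rw [r4, r6, r5] at h
  have hmain : (2 - (4 : ℝ)) * (((n : ℝ) ^ 4)⁻¹ - 4 * (n : ℝ) ^ 2 * ((n : ℝ) ^ 6)⁻¹) = 6 / (n : ℝ) ^ 4 := by
    field_simp
    ring
  rw [hmain] at h
  have h3 : 3 * curvaturePlaquetteCorr (d := 4) (by norm_num) (n : ℤ) =
      latticeGreen (Pi.single (0 : Fin 4) ((n : ℤ) + 1) : Site 4) +
        latticeGreen (Pi.single (0 : Fin 4) ((n : ℤ) - 1) : Site 4) -
        2 * latticeGreen (Pi.single (0 : Fin 4) (n : ℤ) : Site 4) := by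
    rw [hc]; ring
  rw [h3]
  have e3 : 6 * (Real.Gamma ((4 : ℝ) / 2 - 1) / (2 * π ^ ((4 : ℝ) / 2))) / (n : ℝ) ^ 4 =
      Real.Gamma ((4 : ℝ) / 2 - 1) / (2 * π ^ ((4 : ℝ) / 2)) * (6 / (n : ℝ) ^ 4) := by ring
  rw [e3, div_eq_mul_inv K]
  exact h

/-- **FLOOR, PROVED** — support item `stmt-QuantumFields-19457` of route `WeakCouplingRates` (and stub F1 of ThermalRuler's birth
line): the axis curvature two-point function of the `ℤ⁴` lattice Maxwell field has the eventual power floor `|C(n)| ≥ 1/(2π²n⁴)`.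
[cite: Lawler1991, Thm. 1.5.5] -/
theorem curvatureCorrPowerFloor_proof : Summit.QuantumFields.YangMills.Theses.WeakCouplingRates.CurvatureCorrPowerFloor := by
  obtain ⟨K, hK0, hK⟩ := curvaturePlaquetteCorr_axis_asymptotics
  set a : ℝ := Real.Gamma ((4 : ℝ) / 2 - 1) / (2 * π ^ ((4 : ℝ) / 2)) with ha
  have ha1 : a = 1 / (2 * π ^ (2 : ℝ)) := by
    rw [ha, show (4 : ℝ) / 2 - 1 = 1 by norm_num, Real.Gamma_one, show (4 : ℝ) / 2 = 2 by norm_num]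
  have hapos : 0 < a := by rw [ha1]; positivity
  refine ⟨a, hapos, ⌈K / (3 * a)⌉₊ + 1, fun n hn => ?_⟩
  have hn1 : 1 ≤ n := by omega
  have hnR : (0 : ℝ) < n := by exact_mod_cast (show 0 < n by omega)
  have hKn : K / (3 * a) ≤ n := by
    have h1 : K / (3 * a) ≤ ⌈K / (3 * a)⌉₊ := Nat.le_ceil _
    have h2 : (⌈K / (3 * a)⌉₊ : ℝ) ≤ n := by exact_mod_cast (show ⌈K / (3 * a)⌉₊ ≤ n by omega)
    linarith
  have h := hK n hn1
  have hKle : K / (n : ℝ) ^ 5 ≤ 3 * a / (n : ℝ) ^ 4 := by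
    have hK3 : K ≤ 3 * a * n := by
      have := mul_le_mul_of_nonneg_left hKn (by positivity : (0 : ℝ) ≤ 3 * a)
      rwa [mul_div_cancel₀ _ (by positivity : (3 : ℝ) * a ≠ 0)] at this
    rw [div_le_div_iff₀ (by positivity) (by positivity)]
    calc K * (n : ℝ) ^ 4 ≤ 3 * a * n * (n : ℝ) ^ 4 := mul_le_mul_of_nonneg_right hK3 (by positivity)
      _ = 3 * a * (n : ℝ) ^ 5 := by ring
  have hlow : a / (n : ℝ) ^ 4 ≤ curvaturePlaquetteCorr (d := 4) (by norm_num) (n : ℤ) := by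
    have h1 := (abs_le.1 (h.trans hKle)).1
    have e : 6 * a / (n : ℝ) ^ 4 = 2 * (3 * a / (n : ℝ) ^ 4) := by ring
    rw [e] at h1
    have e2 : a / (n : ℝ) ^ 4 = (3 * a / (n : ℝ) ^ 4) / 3 := by ring
    rw [e2]
    linarith
  exact hlow.trans (le_abs_self _)

end Summit.QuantumFields.YangMills.Theorems.WeakCouplingRates
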